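import Summits.CriticalPhenomena.PercolationContinuityZ3.Theses.PercLowPointHalfSpace
import Summits.CriticalPhenomena.PercolationContinuityZ3.Theorems.BoundaryTwoArmDecay.Negative.OneArmLowerBound
import Literature.Probability.Percolation.HalfSpacePinnedPairs
import Literature.Probability.Percolation.BondPercolationSymmetry
import Literature.Probability.Percolation.LatticeSymmetry
import Literature.Probability.Percolation.SiteConnectionTools

/-!
# Stub `stub_step` of crux `BoundaryTwoArmDecay` (stmt-CriticalPhenomena-0911), part 1: the vertical kiss
# event, its measurability and its floor symmetries

Helper file for the stub `stub_step` (ONE ROUND of the bootstrap) of the crux skeleton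
`Cruxes/BoundaryTwoArmDecay/Lines/staircase_bootstrap_floor_decoupling.lean` (line
`staircase-bootstrap-floor-decoupling`, crux `PercLowPointHalfSpace.BoundaryTwoArmDecay`); lands with
`--supports stmt-CriticalPhenomena-0911`.

Objects (same bodies as in the skeleton, so that the registered stub is their unfolding):

* `kissV m x j` — the vertical-reach KISS event at the floor edge `(x, x + e_j)`: the `ℍ`-clusters of `x` and of
  `x + e_j` both meet level `m` and are distinct (`ℍ = halfSpace 3 = {z | 0 ≤ z 0}`); the crux-line event is
  `A_n = kissV n 0 1`;
* `kiss m a b` — the same event for an arbitrary pair of roots `a, b` (`kissV m x j = kiss m x (x + e_j)` by `rfl`).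

Content:

* `measurableSet_kiss` (countable Boolean combinations of the measurable events `{u ↔ v in ℍ}`,
  `measurableSet_openConnIn_of_countable`);
* `kissV_antitone_level` (level `m' ≥ m` reached ⇒ level `m` reached);
* **floor symmetries** `real_kissV_eq`: for a floor root `x` (`x 0 = 0`) and a floor direction `j ≠ 0`,
  `P(kissV m x j) = P(kissV m 0 1)`. Proof: a lattice automorphism `ψ` of `ℤ³` preserving heights
  (`(ψ u) 0 = u 0`) maps `ℍ` onto `ℍ` and levels onto levels, so `(ψ '' ·)⁻¹ (kiss m (ψ a) (ψ b)) = kiss m a b`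
  (`preimage_relabel_kiss`) and `P` is `ψ`-invariant (`bondPercolation_real_preimage_relabel_iso`, Grimmett 1999 §1.6);
  applied to the horizontal translation `u ↦ u + x` (`zdShiftIso`) and to the transposition of the two floor
  coordinates (`zdSignedPermIso (Equiv.swap 1 2) 1`, which fixes `0` and maps `e₂ ↦ e₁`).

References: G. Grimmett, *Percolation*, 2nd ed. (1999), §1.6 (invariance of `P_p` under lattice symmetries),
§7.2 (paths "in `A`").
-/

noncomputable section

namespace Summit.CriticalPhenomena.PercolationContinuityZ3.Theorems.BoundaryTwoArmDecay

open MeasureTheory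
open Literature.Probability.Percolation Literature.Probability.LatticeModels

namespace StubStep

open Negative (μ)

/-! ### The kiss events -/

/-- `kiss m a b`: the `ℍ`-clusters of the roots `a` and `b` both meet level `m`, and `a ↮_ℍ b`. -/
def kiss (m : ℕ) (a b : Site 3) : Set (BondConfig (Site 3)) :=
  {ω | (∃ y : Site 3, (m : ℤ) ≤ y 0 ∧ ω ∈ openConnIn (halfSpace 3) a y) ∧
       (∃ y : Site 3, (m : ℤ) ≤ y 0 ∧ ω ∈ openConnIn (halfSpace 3) b y) ∧
       ω ∉ openConnIn (halfSpace 3) a b}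

/-- `kissV m x j` — the vertical-reach KISS event at the floor edge `(x, x + e_j)` (the skeleton's body):
both `ℍ`-clusters meet level `m` and are distinct. -/
def kissV (m : ℕ) (x : Site 3) (j : Fin 3) : Set (BondConfig (Site 3)) :=
  {ω | (∃ y : Site 3, (m : ℤ) ≤ y 0 ∧ ω ∈ openConnIn (halfSpace 3) x y) ∧
       (∃ y : Site 3, (m : ℤ) ≤ y 0 ∧ ω ∈ openConnIn (halfSpace 3) (x + Pi.single j 1) y) ∧
       ω ∉ openConnIn (halfSpace 3) x (x + Pi.single j 1)}

/-- `kissV m x j = kiss m x (x + e_j)`, definitionally. -/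
theorem kissV_eq_kiss (m : ℕ) (x : Site 3) (j : Fin 3) : kissV m x j = kiss m x (x + Pi.single j 1) := rfl

/-- The kiss event is antitone in the level: reaching level `m'` implies reaching every level `m ≤ m'`. -/
theorem kiss_antitone_level {m m' : ℕ} (h : m ≤ m') (a b : Site 3) : kiss m' a b ⊆ kiss m a b := by
  rintro ω ⟨⟨y, hy, hc⟩, ⟨y', hy', hc'⟩, hne⟩
  have hm : (m : ℤ) ≤ m' := by exact_mod_cast h
  exact ⟨⟨y, hm.trans hy, hc⟩, ⟨y', hm.trans hy', hc'⟩, hne⟩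

/-- `kissV` is antitone in the level. -/
theorem kissV_antitone_level {m m' : ℕ} (h : m ≤ m') (x : Site 3) (j : Fin 3) :
    kissV m' x j ⊆ kissV m x j :=
  kiss_antitone_level h x (x + Pi.single j 1)

/-! ### Measurability -/

/-- The event "the `ℍ`-cluster of `c` meets level `m`" is measurable (a countable union of the measurable
events `{c ↔ y in ℍ}`). -/
theorem measurable_tall (m : ℕ) (c : Site 3) :
    Measurable fun ω : BondConfig (Site 3) =>
      ∃ y : Site 3, (m : ℤ) ≤ y 0 ∧ ω ∈ openConnIn (halfSpace 3) c y :=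
  Measurable.exists fun y =>
    measurable_const.and (measurable_mem.2 (measurableSet_openConnIn_of_countable _ c y))

/-- `kiss m a b` is measurable. -/
theorem measurableSet_kiss (m : ℕ) (a b : Site 3) : MeasurableSet (kiss m a b) :=
  measurableSet_setOf.2 ((measurable_tall m a).and ((measurable_tall m b).and
    (measurable_mem.2 (measurableSet_openConnIn_of_countable _ _ _)).not))

/-- `kissV m x j` is measurable. -/
theorem measurableSet_kissV (m : ℕ) (x : Site 3) (j : Fin 3) : MeasurableSet (kissV m x j) :=
  measurableSet_kiss m x (x + Pi.single j 1)

/-! ### Transport along height-preserving lattice automorphisms -/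

/-- A bijection of `ℤ³` preserving heights maps `ℍ` onto `ℍ`. -/
theorem image_halfSpace_eq (φ : Site 3 ≃ Site 3) (hφ : ∀ u : Site 3, φ u 0 = u 0) :
    φ '' halfSpace 3 = halfSpace 3 := by
  ext y
  constructor
  · rintro ⟨u, hu, rfl⟩
    show (0 : ℤ) ≤ φ u 0
    rw [hφ]
    exact hu
  · intro hy
    refine ⟨φ.symm y, ?_, φ.apply_symm_apply y⟩
    show (0 : ℤ) ≤ φ.symm y 0
    have h := hφ (φ.symm y)
    rw [φ.apply_symm_apply] at h
    rw [← h]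
    exact hy

/-- The inverse of a height-preserving bijection preserves heights. -/
theorem symm_apply_zero (φ : Site 3 ≃ Site 3) (hφ : ∀ u : Site 3, φ u 0 = u 0) (u : Site 3) :
    φ.symm u 0 = u 0 := by
  have h := hφ (φ.symm u)
  rw [φ.apply_symm_apply] at h
  exact h.symm

/-- Transport of `{u ↔ v in ℍ}` along a height-preserving bijection `φ` of `ℤ³`:
`φ '' ω ∈ {φ u ↔ φ v in ℍ} ↔ ω ∈ {u ↔ v in ℍ}`. -/
theorem relabel_mem_openConnIn_iff (φ : Site 3 ≃ Site 3) (hφ : ∀ u : Site 3, φ u 0 = u 0)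
    (ω : BondConfig (Site 3)) (u v : Site 3) :
    BondConfig.relabel (sym2Equiv φ) ω ∈ openConnIn (halfSpace 3) (φ u) (φ v) ↔
      ω ∈ openConnIn (halfSpace 3) u v := by
  constructor
  · intro h
    have h' := relabel_mem_openConnIn φ.symm h
    rw [relabel_symm_relabel, image_halfSpace_eq φ.symm (symm_apply_zero φ hφ), φ.symm_apply_apply,
      φ.symm_apply_apply] at h'
    exact h'
  · intro h
    have h' := relabel_mem_openConnIn φ h
    rw [image_halfSpace_eq φ hφ] at h'
    exact h'

/-- The kiss event at the image roots pulls back to the kiss event: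
`(φ '' ·)⁻¹ (kiss m (φ a) (φ b)) = kiss m a b` for a height-preserving bijection `φ`. -/
theorem preimage_relabel_kiss (φ : Site 3 ≃ Site 3) (hφ : ∀ u : Site 3, φ u 0 = u 0) (m : ℕ)
    (a b : Site 3) :
    BondConfig.relabel (sym2Equiv φ) ⁻¹' kiss m (φ a) (φ b) = kiss m a b := by
  have hφ' := symm_apply_zero φ hφ
  have hex : ∀ (ω : BondConfig (Site 3)) (c : Site 3),
      (∃ y : Site 3, (m : ℤ) ≤ y 0 ∧
          BondConfig.relabel (sym2Equiv φ) ω ∈ openConnIn (halfSpace 3) (φ c) y) ↔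
        ∃ y : Site 3, (m : ℤ) ≤ y 0 ∧ ω ∈ openConnIn (halfSpace 3) c y := by
    intro ω c
    refine φ.symm.exists_congr fun y => ?_
    rw [hφ' y]
    refine and_congr Iff.rfl ?_
    have h := relabel_mem_openConnIn_iff φ hφ ω c (φ.symm y)
    rwa [φ.apply_symm_apply] at h
  ext ω
  simp only [Set.mem_preimage, kiss, Set.mem_setOf_eq]
  rw [hex ω a, hex ω b, relabel_mem_openConnIn_iff φ hφ ω a b]

/-- **Invariance.** For a height-preserving automorphism `ψ` of the lattice `ℤ³`,
`P(kiss m a b) = P(kiss m (ψ a) (ψ b))` (`P_{p_c}` is `ψ`-invariant, Grimmett 1999 §1.6). -/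
theorem real_kiss_iso (ψ : zdGraph 3 ≃g zdGraph 3) (hψ : ∀ u : Site 3, ψ u 0 = u 0) (m : ℕ)
    (a b : Site 3) : μ.real (kiss m a b) = μ.real (kiss m (ψ a) (ψ b)) := by
  rw [← preimage_relabel_kiss ψ.toEquiv (fun u => hψ u) m a b]
  exact bondPercolation_real_preimage_relabel_iso ψ (criticalProbI 3) _

/-! ### The two floor symmetries -/

/-- Horizontal translation: `P(kissV m x j) = P(kissV m 0 j)` for a floor root `x` (`x 0 = 0`). -/
theorem real_kissV_shift {x : Site 3} (hx : x 0 = 0) (m : ℕ) (j : Fin 3) :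
    μ.real (kissV m x j) = μ.real (kissV m 0 j) := by
  have hψ : ∀ u : Site 3, zdShiftIso x u 0 = u 0 := fun u => by
    rw [zdShiftIso_apply, Pi.add_apply, hx, add_zero]
  have h := real_kiss_iso (zdShiftIso x) hψ m 0 (0 + Pi.single j 1)
  rw [zdShiftIso_apply, zdShiftIso_apply, zero_add, zero_add, add_comm] at h
  rw [kissV_eq_kiss, kissV_eq_kiss, zero_add]
  exact h.symm

/-- The transposition of the two floor coordinates preserves heights. -/
theorem swap12_apply_zero (u : Site 3) : zdSignedPermIso (Equiv.swap 1 2) 1 u 0 = u 0 := by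
  rw [zdSignedPermIso_apply, Site.signedPerm_apply, Equiv.symm_swap,
    Equiv.swap_apply_of_ne_of_ne (by decide) (by decide)]
  simp

/-- The transposition of the two floor coordinates maps `e₂` to `e₁`. -/
theorem swap12_single_two : zdSignedPermIso (Equiv.swap 1 2) 1 (Pi.single 2 1 : Site 3) = Pi.single 1 1 := by
  rw [zdSignedPermIso_apply, Site.signedPerm_single, Equiv.swap_apply_right]
  simp

/-- Transposition of the floor coordinates: `P(kissV m 0 2) = P(kissV m 0 1)`. -/
theorem real_kissV_swap (m : ℕ) : μ.real (kissV m 0 2) = μ.real (kissV m 0 1) := by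
  have h := real_kiss_iso (zdSignedPermIso (Equiv.swap 1 2) 1) swap12_apply_zero m 0 (Pi.single 2 1)
  rw [swap12_single_two] at h
  have h0 : zdSignedPermIso (Equiv.swap 1 2) 1 (0 : Site 3) = 0 := by
    rw [zdSignedPermIso_apply, Site.signedPerm_zero]
  rw [h0] at h
  rw [kissV_eq_kiss, kissV_eq_kiss, zero_add, zero_add]
  exact h

/-- A non-vertical direction of `ℤ³` is one of the two floor directions. -/
theorem eq_one_or_two_of_ne_zero {j : Fin 3} (hj : j ≠ 0) : j = 1 ∨ j = 2 := by
  fin_cases j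
  · exact absurd rfl hj
  · exact Or.inl rfl
  · exact Or.inr rfl

/-- **Floor symmetries of the kiss event**: for a floor root `x` and a floor direction `j`,
`P(kissV m x j) = P(kissV m 0 1)`. -/
theorem real_kissV_eq {x : Site 3} (hx : x 0 = 0) {j : Fin 3} (hj : j ≠ 0) (m : ℕ) :
    μ.real (kissV m x j) = μ.real (kissV m 0 1) := by
  rw [real_kissV_shift hx]
  rcases eq_one_or_two_of_ne_zero hj with rfl | rfl
  · rfl
  · exact real_kissV_swap m

end StubStep

/-- **Registered sub-goal `stub_step_symm`** (def-free summary of this helper file): the floor symmetries of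
the vertical kiss event, `P(kissV m x j) = P(kissV m 0 1)` for a floor root `x` (`x 0 = 0`) and a floor
direction `j ≠ 0`, in the skeleton's inlined text (`StubStep.real_kissV_eq`). -/
theorem stub_step_symm : ∀ (m : ℕ) (x : Site 3) (j : Fin 3), x 0 = 0 → j ≠ 0 → (bondPercolation (zdGraph 3) (criticalProbI 3)).real {ω | (∃ y : Site 3, (m : ℤ) ≤ y 0 ∧ ω ∈ openConnIn (halfSpace 3) x y) ∧ (∃ y : Site 3, (m : ℤ) ≤ y 0 ∧ ω ∈ openConnIn (halfSpace 3) (x + Pi.single j 1) y) ∧ ω ∉ openConnIn (halfSpace 3) x (x + Pi.single j 1)} = (bondPercolation (zdGraph 3) (criticalProbI 3)).real {ω | (∃ y : Site 3, (m : ℤ) ≤ y 0 ∧ ω ∈ openConnIn (halfSpace 3) 0 y) ∧ (∃ y : Site 3, (m : ℤ) ≤ y 0 ∧ ω ∈ openConnIn (halfSpace 3) ((0 : Site 3) + Pi.single 1 1) y) ∧ ω ∉ openConnIn (halfSpace 3) 0 ((0 : Site 3) + Pi.single 1 1)} :=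
  fun m _ _ hx hj => StubStep.real_kissV_eq hx hj m

end Summit.CriticalPhenomena.PercolationContinuityZ3.Theorems.BoundaryTwoArmDecay

end
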